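import Summits.Langlands.Langlands.Theorems.AbelianSurfaceSerreSerreGSp4SurjectiveSingerDefs
import Literature.RepresentationTheory.Semisimple.CliffordCyclicTwist
import HarnessLib

/-!
# Stub `stub_coxeterAdequate` (line `singer-type-evaporation`, crux `SerreGSp4Surjective`,
# stmt-Langlands-17765)

Registered stub 2/6 of the checked skeleton of the line: for a residual `ρ' : Γ_ℚ → GL₄(k)`
(`k` finite of characteristic `ℓ`) carrying a COXETER PAIR at a place `w` for `(e, d)` with `e` of
multiplicative order `4` modulo `d` (`CoxeterPairAt e d w ρ'`) and a TWIST CERTIFICATE at `ℓ`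
(`TwistCertificate ℓ ρ'`), the base change `ρ' ⊗ k̄` restricted to `ker ε̄_ℓ = Γ_{ℚ(ζ_ℓ)}` is
irreducible (`IrredOnCycKernel ℓ ρ'`, the adequacy-type image hypothesis of BLGGT Thm 4.2.1 that
`stub_automorphyLifting` consumes).

Proof (pure algebra, over `K = k̄`, `V = K⁴`, `G = Γ_ℚ`, `N = ker ε̄_ℓ`, `R = ρ' ⊗ K`).
1. *Coxeter rigidity* (`eq_bot_or_eq_top_of_coxeter`): `M = R(τ)` has characteristic polynomial
   `∏_{i<4} (X - ζ^{e^i})`; since `e` has order `4` mod `d` (which forces `d ≠ 0`) and `ζ` is a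
   primitive `d`-th root of unity, the eigenvalues `μ_i = ζ^{e^i}` are pairwise distinct and
   `μ_i ^ e = μ_{i+1}` (indices mod `4`).  From `R(φ) M = M ^ e R(φ)` the operator `R(φ)` moves the
   `μ_i`-eigenline to the `μ_{i-1}`-eigenline, a `4`-cycle, so a subspace stable under `M` and
   `R(φ)` (its `M`-components are extracted by Lagrange interpolation polynomials in `M`) is `⊥`
   or `⊤`: `V` is `G`-irreducible.
2. *Cyclic quotient*: `G / N ↪ (ℤ/ℓ)ˣ` is cyclic, so `G = ⋃ⱼ g₀ ^ j N` with `g₀ ^ m ∈ N` for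
   `m = ord ε̄_ℓ(g₀) ∣ ℓ - 1`, invertible in `K` (`char K = ℓ`).
3. *Clifford twist* (`exists_twist_scalar_of_reducible_restrict` of
   `Literature/RepresentationTheory/Semisimple/CliffordCyclicTwist.lean`, Clifford theory for the
   cyclic quotient `G / N`): were some `N`-subrepresentation `≠ ⊥, ⊤`, there would be `ν ≠ 1` with
   `ν ^ 4 = 1` and `tr R(g₀ ^ j n) = ν ^ j tr R(g₀ ^ j n)`.
4. *The certificate*: `σ = g₀ ^ j n` has `ε̄_ℓ(σ) = ε̄_ℓ(g₀) ^ j` a non-square, so `j` is odd, and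
   `tr R(σ) = ι(tr ρ'(σ)) ≠ 0`, so `ν ^ j = 1`; with `ν ^ 4 = 1` and `gcd(4, j) = 1` this gives
   `ν = 1`, a contradiction.

References: BarnetlambEtAl2014 Thm 4.2.1 (where the conclusion is consumed); Clifford 1937.
-/

set_option linter.dupNamespace false -- `Summit.Langlands.Langlands` is the mandated namespace

namespace Summit.Langlands.Langlands.Cruxes.SerreGSp4Surjective.SingerTypeEvaporation

open Literature.NumberTheory.GaloisRepresentations Literature.NumberTheory.Automorphic
  Literature.NumberTheory.PAdicHodge Literature.RepresentationTheory.Semisimple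
open scoped NumberField
open IsDedekindDomain Polynomial Module

noncomputable section

/-! ## Coxeter rigidity (linear algebra) -/

section CoxeterRigidity

variable {K V : Type*} [Field K] [AddCommGroup V] [Module K V] [FiniteDimensional K V]

omit [FiniteDimensional K V] in
/-- Polynomials in an endomorphism preserve its invariant subspaces. -/
theorem aeval_apply_mem {m : Module.End K V} {W : Submodule K V}
    (hWm : ∀ v ∈ W, m v ∈ W) (q : K[X]) {w : V} (hw : w ∈ W) : aeval m q w ∈ W :=
  aeval_apply_smul_mem_of_le_comap hw q m fun v hv => hWm v hv

/-- **Coxeter rigidity.** Let `m` have the four distinct eigenvalues `μ i` with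
`μ (i + 1) = (μ i) ^ e`, and let an invertible `p` satisfy `p m = m ^ e p`.  Then `p` permutes the
four eigenlines of `m` cyclically, so a subspace stable under `m` and `p` is `⊥` or `⊤`. -/
theorem eq_bot_or_eq_top_of_coxeter (hV : finrank K V = 4) (m p : Module.End K V)
    (hp : Function.Injective p) (μ : Fin 4 → K) (hμ : Function.Injective μ) (e : ℕ)
    (hμe : ∀ i, μ i ^ e = μ (i + 1)) (hm : m.charpoly = ∏ i, (X - C (μ i)))
    (hpm : p * m = m ^ e * p) (W : Submodule K V) (hWm : ∀ v ∈ W, m v ∈ W)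
    (hWp : ∀ v ∈ W, p v ∈ W) : W = ⊥ ∨ W = ⊤ := by
  classical
  -- eigenvectors
  have heig : ∀ i, m.HasEigenvalue (μ i) := fun i => by
    rw [Module.End.hasEigenvalue_iff_isRoot_charpoly, hm, IsRoot, eval_prod]
    exact Finset.prod_eq_zero (Finset.mem_univ i) (by simp)
  choose v hv using fun i => (heig i).exists_hasEigenvector
  have hli : LinearIndependent K v := m.eigenvectors_linearIndependent' μ hμ v hv
  have hspan : Submodule.span K (Set.range v) = ⊤ :=
    hli.span_eq_top_of_card_eq_finrank' (by simp [hV])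
  -- extraction of components: if `∑ c i • v i ∈ W` and `c i ≠ 0` then `v i ∈ W`
  have hext : ∀ c : Fin 4 → K, (∑ j, c j • v j) ∈ W → ∀ i, c i ≠ 0 → v i ∈ W := by
    intro c hc i hi
    set q : K[X] := ∏ j ∈ Finset.univ.erase i, (X - C (μ j)) with hq
    have hqW := aeval_apply_mem hWm q hc
    have hqv : ∀ j, aeval m q (v j) = (if j = i then q.eval (μ i) else 0) • v j := by
      intro j
      rw [Module.End.aeval_apply_of_hasEigenvector (hv j)]
      split_ifs with hji
      · rw [hji]
      · rw [hq, eval_prod]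
        rw [Finset.prod_eq_zero (Finset.mem_erase.2 ⟨hji, Finset.mem_univ j⟩) (by simp)]
    have hqi : q.eval (μ i) ≠ 0 := by
      rw [hq, eval_prod]
      refine Finset.prod_ne_zero_iff.2 fun j hj => ?_
      have hji : j ≠ i := (Finset.mem_erase.1 hj).1
      simpa [sub_eq_zero] using fun h => hji (hμ h.symm)
    rw [map_sum] at hqW
    simp_rw [map_smul, hqv, smul_smul] at hqW
    rw [Finset.sum_eq_single i (fun j _ hji => by simp [hji]) (by simp)] at hqW
    simp only [if_true] at hqW
    have hci : c i * q.eval (μ i) ≠ 0 := mul_ne_zero hi hqi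
    have := W.smul_mem (c i * q.eval (μ i))⁻¹ hqW
    rwa [smul_smul, inv_mul_cancel₀ hci, one_smul] at this
  -- `p` moves the eigenline `i` to the eigenline `i - 1`
  have hshift : ∀ i, v i ∈ W → v (i - 1) ∈ W := by
    intro i hi
    obtain ⟨a, ha⟩ := (Submodule.mem_span_range_iff_exists_fun K).1
      (hspan ▸ Submodule.mem_top (x := p (v i)))
    -- compare `m ^ e (p (v i)) = μ i • p (v i)` coordinatewise
    have h1 : (m ^ e) (p (v i)) = μ i • p (v i) := by
      rw [← Module.End.mul_apply, ← hpm, Module.End.mul_apply, (hv i).apply_eq_smul, map_smul]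
    have h2 : ∑ j, (a j * μ (j + 1) - μ i * a j) • v j = 0 := by
      simp_rw [sub_smul, Finset.sum_sub_distrib, mul_smul, ← hμe, ← (hv _).pow_apply e,
        ← map_smul, ← map_sum, ← Finset.smul_sum, ha, h1, sub_self]
    have h3 := Fintype.linearIndependent_iff.1 hli _ h2
    have ha0 : ∀ j, j + 1 ≠ i → a j = 0 := fun j hj => by
      have := h3 j
      rw [mul_comm (μ i), ← mul_sub, mul_eq_zero, sub_eq_zero] at this
      exact this.resolve_right fun h => hj (hμ h)
    have hpa : p (v i) = a (i - 1) • v (i - 1) := by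
      rw [← ha, Finset.sum_eq_single (i - 1) (fun j _ hj => ?_) (by simp)]
      rw [ha0 j (fun h => hj (by rw [← h]; simp)), zero_smul]
    have hane : a (i - 1) ≠ 0 := by
      intro h0
      rw [h0, zero_smul, ← map_zero p] at hpa
      exact (hv i).2 (hp hpa)
    have hpW : p (v i) ∈ W := hWp _ hi
    rw [hpa] at hpW
    have := W.smul_mem (a (i - 1))⁻¹ hpW
    rwa [smul_smul, inv_mul_cancel₀ hane, one_smul] at this
  -- conclusion
  by_cases hS : ∃ i, v i ∈ W
  · obtain ⟨i, hi⟩ := hS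
    have hall : ∀ j, v j ∈ W := by
      have h1 := hshift _ hi
      have h2 := hshift _ h1
      have h3 := hshift _ h2
      intro j
      have key : ∀ i j : Fin 4, j = i ∨ j = i - 1 ∨ j = i - 1 - 1 ∨ j = i - 1 - 1 - 1 := by
        decide
      rcases key i j with rfl | rfl | rfl | rfl <;> assumption
    right
    rw [eq_top_iff, ← hspan, Submodule.span_le]
    rintro _ ⟨j, rfl⟩
    exact hall j
  · push Not at hS
    left
    rw [eq_bot_iff]
    intro w hw
    obtain ⟨c, rfl⟩ := (Submodule.mem_span_range_iff_exists_fun K).1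
      (hspan ▸ Submodule.mem_top (x := w))
    have hc : ∀ i, c i = 0 := fun i => by
      by_contra hci
      exact hS i (hext c hw i hci)
    simp [hc]
end CoxeterRigidity

/-! ## The stub -/

/-- **Stub `stub_coxeterAdequate` (registered signature, verbatim).**  A residual
`ρ' : Γ_ℚ → GL₄(k)` with a Coxeter pair at `w` for `(e, d)`, `e` of order `4` modulo `d`, and a
twist certificate at `ℓ` is absolutely irreducible on `Γ_{ℚ(ζ_ℓ)} = ker ε̄_ℓ`: the Coxeter pair
makes `ρ' ⊗ k̄` irreducible under `Γ_ℚ`, the Clifford twist lemma turns a proper nonzero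
`ker ε̄_ℓ`-subrepresentation into `ν ≠ 1` with `ν ^ 4 = 1` and `tr = ν ^ j · tr` on
`g₀ ^ j ker ε̄_ℓ`, and the certificate's `σ` (odd `j`, nonzero trace) forces `ν = 1`. -/
theorem stub_coxeterAdequate :
    ∀ (ℓ : ℕ) [Fact ℓ.Prime] (e d : ℕ) (w : HeightOneSpectrum (𝓞 ℚ)) (k : Type) [Field k]
      [Fintype k] [CharP k ℓ] [TopologicalSpace k] [DiscreteTopology k]
      (ρ' : FramedGaloisRep ℚ k 4),
      orderOf ((e : ℕ) : ZMod d) = 4 → CoxeterPairAt e d w ρ' → TwistCertificate ℓ ρ' →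
        IrredOnCycKernel ℓ ρ' := by
  intro ℓ _ e d w k _ _ _ _ _ ρ' he hcox htw
  classical
  -- the players: `K = k̄`, `R = ρ' ⊗ K` on `V = K⁴`, `ε = ε̄_ℓ`, `N = ker ε`
  let K := AlgebraicClosure k
  let ι : k →+* K := algebraMap k K
  set R : Representation K (Field.absoluteGaloisGroup ℚ) (Fin 4 → K) :=
    FramedRep.baseChangeRepresentation ι ρ' with hRdef
  set ε : Field.absoluteGaloisGroup ℚ →* (ZMod ℓ)ˣ := modPCyclotomicCharacterZMod ℚ ℓ with hεdef
  set N : Subgroup (Field.absoluteGaloisGroup ℚ) := ε.ker with hNdef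
  let F : GL (Fin 4) k →* Module.End K (Fin 4 → K) :=
    (glStdRepresentation (Fin 4) K).comp (Matrix.GeneralLinearGroup.map ι)
  have hRF : ∀ g, R g = F (ρ' g) := fun g => rfl
  have hR : ∀ g, R g = Matrix.toLin' ((ρ' g).val.map ι) := fun g =>
    LinearMap.ext fun v => by
      rw [Matrix.toLin'_apply, hRdef, FramedRep.baseChangeRepresentation_apply_apply]; rfl
  -- (1) `V` is irreducible under `G` (Coxeter rigidity)
  obtain ⟨ζ, τ, φ, hζ, hchar, hconj⟩ := hcox
  set τ' := absGaloisRestrict ℚ (w.adicCompletion ℚ) τ with hτ'def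
  set φ' := absGaloisRestrict ℚ (w.adicCompletion ℚ) φ with hφ'def
  set μ : Fin 4 → K := fun i => ζ ^ e ^ (i : ℕ) with hμdef
  have hm : (R τ').charpoly = ∏ i, (X - C (μ i)) := by
    rw [hR, Matrix.charpoly_toLin', Matrix.charpoly_map]
    exact hchar
  have hkey : ρ' φ' * ρ' τ' = ρ' τ' ^ e * ρ' φ' := by
    have h1 : ρ' (φ' * τ' * φ'⁻¹) = ρ' τ' ^ e := by
      simpa only [FramedGaloisRep.toLocal_apply, map_mul, map_inv] using hconj
    rw [map_mul, map_mul, map_inv] at h1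
    exact mul_inv_eq_iff_eq_mul.1 h1
  have hpm : R φ' * R τ' = R τ' ^ e * R φ' := by
    rw [hRF, hRF, ← map_mul, hkey, map_mul, map_pow]
  have hp : Function.Injective (R φ') := rep_apply_injective R φ'
  have he4 : (e : ZMod d) ^ 4 = 1 := by rw [← he]; exact pow_orderOf_eq_one _
  have hd : d ≠ 0 := by
    rintro rfl
    have h1 : e ^ 4 ≡ 1 [MOD 0] := by
      rw [← ZMod.natCast_eq_natCast_iff, Nat.cast_pow, Nat.cast_one]; exact he4
    rw [Nat.modEq_zero_iff, pow_eq_one_iff] at h1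
    rw [h1.resolve_right (by norm_num), Nat.cast_one, orderOf_one] at he
    norm_num at he
  have hζpow : ∀ a b : ℕ, (a : ZMod d) = b → ζ ^ a = ζ ^ b := by
    intro a b hab
    rw [ZMod.natCast_eq_natCast_iff'] at hab
    rw [← pow_mod_orderOf ζ a, ← pow_mod_orderOf ζ b, ← hζ.eq_orderOf, hab]
  have hμinj : Function.Injective μ := by
    intro i j hij
    simp only [hμdef] at hij
    rw [← pow_mod_orderOf ζ (e ^ (i : ℕ)), ← pow_mod_orderOf ζ (e ^ (j : ℕ)), ← hζ.eq_orderOf]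
      at hij
    have h1 := hζ.pow_inj (Nat.mod_lt _ (Nat.pos_of_ne_zero hd))
      (Nat.mod_lt _ (Nat.pos_of_ne_zero hd)) hij
    rw [← ZMod.natCast_eq_natCast_iff', Nat.cast_pow, Nat.cast_pow] at h1
    have hi : (i : ℕ) ∈ Set.Iio (orderOf (e : ZMod d)) := by simp [he]
    have hj : (j : ℕ) ∈ Set.Iio (orderOf (e : ZMod d)) := by simp [he]
    exact Fin.ext (pow_injOn_Iio_orderOf hi hj h1)
  have hμe : ∀ i, μ i ^ e = μ (i + 1) := by
    intro i
    simp only [hμdef, ← pow_mul, ← pow_succ]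
    apply hζpow
    push_cast
    fin_cases i <;> simp [he4]
  have hirrG : ∀ W : Submodule K (Fin 4 → K), (∀ g, W.map (R g) ≤ W) → W = ⊥ ∨ W = ⊤ :=
    fun W hW => eq_bot_or_eq_top_of_coxeter (Module.finrank_fin_fun K) (R τ') (R φ') hp μ hμinj e
      hμe hm hpm W (fun v hv => hW τ' ⟨v, hv, rfl⟩) (fun v hv => hW φ' ⟨v, hv, rfl⟩)
  -- (2) `G / N` is cyclic: a generator `g₀` modulo `N`, of order `m` prime to `ℓ`
  obtain ⟨⟨c, hc⟩, hgenc⟩ := IsCyclic.exists_monoid_generator (α := ε.range)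
  obtain ⟨g₀, rfl⟩ := hc
  have hgen : ∀ g, ∃ (j : ℕ) (n : Field.absoluteGaloisGroup ℚ), n ∈ N ∧ g = g₀ ^ j * n := by
    intro g
    obtain ⟨j, hj⟩ := (Submonoid.mem_powers_iff _ _).1 (hgenc ⟨ε g, g, rfl⟩)
    rw [Subtype.ext_iff] at hj
    simp only [SubmonoidClass.coe_pow] at hj
    refine ⟨j, (g₀ ^ j)⁻¹ * g, ?_, by group⟩
    rw [hNdef, MonoidHom.mem_ker, map_mul, map_inv, map_pow, hj, inv_mul_cancel]
  set m := orderOf (ε g₀) with hmdef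
  have hmN : g₀ ^ m ∈ N := by rw [hNdef, MonoidHom.mem_ker, map_pow]; exact pow_orderOf_eq_one _
  have hm0 : (m : K) ≠ 0 := by
    have hmdvd : m ∣ ℓ - 1 := by rw [← ZMod.card_units ℓ]; exact orderOf_dvd_card
    have hmpos : 0 < m := orderOf_pos _
    have hℓ := (Fact.out : ℓ.Prime).two_le
    intro h0
    rw [CharP.cast_eq_zero_iff K ℓ] at h0
    have h1 := Nat.le_of_dvd hmpos h0
    have h2 := Nat.le_of_dvd (by omega) hmdvd
    omega
  -- (3) the goal: every `N`-subrepresentation is `⊥` or `⊤`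
  haveI : Nontrivial (Subrepresentation (R.comp N.subtype)) :=
    ⟨⟨⊥, ⊤, fun h => bot_ne_top (congrArg Subrepresentation.toSubmodule h)⟩⟩
  refine ⟨fun Wr => ?_⟩
  have hWN : ∀ n ∈ N, Wr.toSubmodule.map (R n) ≤ Wr.toSubmodule := by
    intro n hn
    rintro _ ⟨v, hv, rfl⟩
    exact Wr.apply_mem_toSubmodule ⟨n, hn⟩ hv
  by_contra hcon
  push Not at hcon
  have hW0 : Wr.toSubmodule ≠ ⊥ := fun h => hcon.1 (Subrepresentation.toSubmodule_injective h)
  have hW1 : Wr.toSubmodule ≠ ⊤ := fun h => hcon.2 (Subrepresentation.toSubmodule_injective h)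
  obtain ⟨ν, hν1, hν4, htr⟩ :=
    exists_twist_scalar_of_reducible_restrict R N g₀ hgen m hmN hm0 hirrG _ hWN hW0 hW1
  -- (4) the twist certificate: `σ = g₀ ^ j n` with `j` odd and `tr R(σ) ≠ 0`, so `ν ^ j = 1`
  obtain ⟨σ, hσtr, hσsq⟩ := htw
  obtain ⟨j, n, hn, hσ⟩ := hgen σ
  have hj : Odd j := by
    refine Nat.not_even_iff_odd.1 fun hev => hσsq ?_
    rw [hNdef, MonoidHom.mem_ker] at hn
    rw [← hεdef, hσ, map_mul, hn, mul_one, map_pow]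
    exact hev.isSquare_pow _
  have hνj : ν ^ j = 1 := by
    have h1 := htr j n hn
    rw [← hσ] at h1
    have h2 : LinearMap.trace K _ (R σ) ≠ 0 := by
      rw [hR, Matrix.trace_toLin'_eq, ← AddMonoidHom.map_trace]
      exact (map_ne_zero_iff ι ι.injective).2 hσtr
    exact (mul_eq_right₀ h2).1 h1.symm
  -- (5) `ν ^ 4 = 1 = ν ^ j` with `j` odd forces `ν = 1`: contradiction
  apply hν1
  have h4 : orderOf ν ∣ 4 := orderOf_dvd_of_pow_eq_one (by rwa [Module.finrank_fin_fun] at hν4)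
  have hjd : orderOf ν ∣ j := orderOf_dvd_of_pow_eq_one hνj
  have hcop : Nat.Coprime 4 j := by
    have h2 : Nat.Coprime 2 j := Nat.coprime_two_left.2 hj
    simpa using h2.pow_left 2
  exact orderOf_eq_one_iff.1 (Nat.eq_one_of_dvd_coprimes hcop h4 hjd)

end

end Summit.Langlands.Langlands.Cruxes.SerreGSp4Surjective.SingerTypeEvaporation
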